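import Mathlib
import Literature.Analysis.FluidPDE.VectorCalculus
import Summits.NavierStokesRegularity.NavierStokesRegularity.Theorems.FilamentSkeletonRssClause13LinearisedMapClauses
import Summits.NavierStokesRegularity.NavierStokesRegularity.Theorems.FilamentSkeletonRssClause13RAdjointOperator

/-!
# Clause 13-R, route (ii′) item (a), CLAUSE LEVEL: the pairing `Σ_j ∫_{S_j} ⟪ψ_j, DT·Y_j⟫` of the cokernel certificate equals `Σ_k ∫_{S_k} ⟪(D^*ψ)_k, Y_k⟫`
# under the LITERAL clause block of the crux (crux `Clause13RNearStraightL`, stmt-NavierStokesRegularity-23612; STUB R `stub_rateRow13RFlat`)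

Route `FilamentSkeletonRss`, Variant A1R.  This file instantiates the analytic pairing identity `…Clause13RAdjointOperator.adjoint_pairing_identity`
from the crux's clause block VERBATIM (the hypothesis `hH`, the near-straight conclusion `hNS`, and the binders `hu, hv, hA, hT` of the registered
STUB R text / of `…Clause13RCokernelCertificate`): `c_k := Γγ_k/4π`, core `m_k := κ·Aa_k` (`κ = e^{−(1+γ_E−log 2)}`) with floor `κΛ⁻¹`
(`Λ ≥ 3/2 + δ > 0` by clause 12, `Λ⁻¹ ≤ Aa` by (iii) of `hNS`), constant value `a₀_k := κ·Aa_k(c_k)` on the open double ball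
`U_k := {‖X_k‖ < 2R_b√(Γ log Γ)} ⊇ S_k ⊇ tsupport Y_k` (clause 13), cone growth from clause 6 (`…Clause13LinearisedMapClauses.linearGrowth_of_cone`),
compact balls from clause 3 (cocompact growth), and the closed form of
`deriv (fun s => T (X + sY) j τ) 0` at in-ball stations (`…Clause13LinearisedMapClauses.deriv_linearisedMap_inBall`):

* `clause_pairing_identity` — for `Γ > 1`, every `C¹` weight family `ψ` and every `C²` test family `Y` vanishing off the balls (the admissible class
  of the certificate, normality and phase not needed): `Σ_j ∫_{S_j} ⟪ψ_jτ, deriv (fun s => T (X + sY) j τ) 0⟫ dτ = Σ_k ∫_{S_k} ⟪(D^*ψ)_k σ, Y_k σ⟫ dσ`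
  with `(D^*ψ)_k` the EXPLICIT adjoint weight of `…Clause13RAdjointOperator` (written out in the statement).

Consequently the exact-annihilation clause of the cokernel certificate holds for any `C¹` family `ψ` solving `(D^*ψ)_k = 0` on `S_k` — census item (a)
of memo STRUCTURE-23612-conformal-cokernel-leafhand8-g1.md is DONE; the open content of STUB R along route (ii′) is the construction (c) of such a `ψ` with
positive mass and the pairing floor.  Hand `leafhand-ns-filamentskeletonrs-10-g0` (LAND-ONLY); `--supports stmt-NavierStokesRegularity-23612` helper.
HONEST FRAMING: bookkeeping at a HYPOTHETICAL near-straight filament skeleton on the NEGATIVE side of a MODEL blow-up route; STUB R is NOT proved here and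
nothing in this file bears on Navier–Stokes regularity or blow-up.
-/

noncomputable section

open MeasureTheory Filter Topology Set
open scoped RealInnerProductSpace InnerProductSpace BigOperators
open Literature.Analysis.FluidPDE
open Summit.NavierStokesRegularity.NavierStokesRegularity.Theorems.Clause13LinearisedMapClauses (linearGrowth_of_cone deriv_linearisedMap_inBall)
open Summit.NavierStokesRegularity.NavierStokesRegularity.Theorems.Clause13RAdjointOperator (adjoint_pairing_identity)

namespace Summit.NavierStokesRegularity.NavierStokesRegularity.Theorems.Clause13RClausePairing
set_option linter.dupNamespace false

/-- **THE PAIRING IDENTITY AT CLAUSE LEVEL** (see the module docstring). [folklore] -/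
theorem clause_pairing_identity {N : ℕ} {δ ρ K Λ Rw cg θ₀ KA Rb Γ α : ℝ} {γ : Fin N → ℝ} {X : Fin N → ℝ → EuclideanSpace ℝ (Fin 3)} {w : Fin N → ℝ → ℝ}
    {c : Fin N → ℝ} {Aa : Fin N → ℝ → ℝ} (hN : 0 < N) (hδ : 0 < δ) (hcg : 0 < cg) (hRb : 0 < Rb) (hΓ : 1 < Γ)
    (hH : (∀ (u:(Fin N → ℝ → EuclideanSpace ℝ (Fin 3)) → EuclideanSpace ℝ (Fin 3) → EuclideanSpace ℝ (Fin 3)) (v:EuclideanSpace ℝ (Fin 3) → EuclideanSpace ℝ (Fin 3)) (A:Fin N → (EuclideanSpace ℝ (Fin 3) →L[ℝ] EuclideanSpace ℝ (Fin 3))) (T:(Fin N → ℝ → EuclideanSpace ℝ (Fin 3)) → Fin N → ℝ → EuclideanSpace ℝ (Fin 3)), (∀ Z y, u Z y = ∑ k, (Γ*γ k/(4*Real.pi))•∫ σ:ℝ, ((‖y-Z k σ‖^2+Real.exp (-(1+Real.eulerMascheroniConstant-Real.log 2))*Aa k σ)^(3/2:ℝ))⁻¹•cross (deriv (Z k) σ)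 (y-Z k σ))→(∀ y, v y = u X y+(1/2:ℝ)•y-α•cross (EuclideanSpace.single 2 1) y)→(∀ j, A j = fderiv ℝ v (X j (c j)))→(∀ Z j τ, T Z j τ = (u Z (Z j τ)+(1/2:ℝ)•Z j τ-α•cross (EuclideanSpace.single 2 1) (Z j τ))-(⟪u Z (Z j τ)+(1/2:ℝ)•Z j τ-α•cross (EuclideanSpace.single 2 1) (Z j τ), deriv (Z j) τ⟫_ℝ/‖deriv (Z j) τ‖^2)•deriv (Z j) τ)→(α ≠ 0 ∧ (∀ j, γ j ≠ 0) ∧ (∀ j, ContDiff ℝ 2 (X j) ∧ Differentiable ℝ (w j)∧(∀ τ, ‖deriv (X j) τ‖ = 1)∧(∀ τ, ‖iteratedDeriv 2 (X j) τ‖*√Γ≤K) ∧ Tendsto (fun τ => ‖X j τ‖) (cocompact ℝ) atTop) ∧ (∀ j k, j ≠ k → ∀ τ σ, ρ*√Γ≤‖X j τ-X k σ‖) ∧ (∀ j τ σ, ρ*√Γ≤|τ-σ| → cg*ρ*√Γ≤‖X j τ-X j σ‖) ∧ (∀ j τ, cg*|τ-c j|≤Rw*√Γ+‖X j τ‖)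 ∧ (∀ j τ, w j τ = ⟪v (X j τ), deriv (X j) τ⟫_ℝ) ∧ (∀ j τ, ‖X j τ‖≤Rb*√(Γ*Real.log Γ) → v (X j τ) = w j τ•deriv (X j) τ) ∧ (∀ j, ‖X j (c j)‖≤Rw*√Γ) ∧ (∀ j, |⟪deriv (X j) (c j), EuclideanSpace.single 2 1⟫_ℝ|≤1-θ₀) ∧ (θ₀≤|α| ∧ |α|≤θ₀⁻¹ ∧ ∀ j, θ₀≤|γ j| ∧ |γ j|≤θ₀⁻¹) ∧ (∀ j, w j (c j) = 0 ∧ (∀ τ, w j τ = 0 → τ = c j) ∧ 3/2+δ≤deriv (w j) (c j) ∧ deriv (w j) (c j)≤Λ) ∧ (∀ j, Differentiable ℝ (Aa j) ∧ (∀ τ, 0 < Aa j τ) ∧ 1≤KA*Aa j (c j) ∧ ∀ τ, ‖X j τ‖≤2*Rb*√(Γ*Real.log Γ) → Aa j τ = Aa j (c j)) ∧ (∀ j τ, Rw^2*Γ*Aa j τ≤KA*(Rw^2*Γ+‖X j τ‖^2)))))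
    (hNS : ((∀ j τ σ, ‖deriv (X j) τ - deriv (X j) σ‖ ≤ Rb) ∧ (∀ j τ, |deriv (w j) τ| ≤ Λ) ∧ (∀ j τ, Λ⁻¹ ≤ Aa j τ)))
    {u : (Fin N → ℝ → EuclideanSpace ℝ (Fin 3)) → EuclideanSpace ℝ (Fin 3) → EuclideanSpace ℝ (Fin 3)} {v : EuclideanSpace ℝ (Fin 3) → EuclideanSpace ℝ (Fin 3)} {A : Fin N → (EuclideanSpace ℝ (Fin 3) →L[ℝ] EuclideanSpace ℝ (Fin 3))}
    {T : (Fin N → ℝ → EuclideanSpace ℝ (Fin 3)) → Fin N → ℝ → EuclideanSpace ℝ (Fin 3)}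
    (hu : ∀ Z y, u Z y = ∑ k, (Γ*γ k/(4*Real.pi))•∫ σ:ℝ, ((‖y-Z k σ‖^2+Real.exp (-(1+Real.eulerMascheroniConstant-Real.log 2))*Aa k σ)^(3/2:ℝ))⁻¹•cross (deriv (Z k) σ) (y-Z k σ)) (hv : ∀ y, v y = u X y+(1/2:ℝ)•y-α•cross (EuclideanSpace.single 2 1) y) (hA : ∀ j, A j = fderiv ℝ v (X j (c j)))
    (hT : ∀ Z j τ, T Z j τ = (u Z (Z j τ)+(1/2:ℝ)•Z j τ-α•cross (EuclideanSpace.single 2 1) (Z j τ))-(⟪u Z (Z j τ)+(1/2:ℝ)•Z j τ-α•cross (EuclideanSpace.single 2 1) (Z j τ), deriv (Z j) τ⟫_ℝ/‖deriv (Z j) τ‖^2)•deriv (Z j) τ)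
    (ψ : Fin N → ℝ → EuclideanSpace ℝ (Fin 3)) (hψ : ∀ j, ContDiff ℝ 1 (ψ j))
    (Y : Fin N → ℝ → EuclideanSpace ℝ (Fin 3)) (hY2 : ∀ j, ContDiff ℝ 2 (Y j)) (hYoff : ∀ j τ, Rb*√(Γ*Real.log Γ) < ‖X j τ‖ → Y j τ = 0) :
    ∑ j, ∫ τ in {σ : ℝ | ‖X j σ‖ ≤ Rb * √(Γ * Real.log Γ)}, ⟪ψ j τ, deriv (fun s:ℝ => T (fun k σ => X k σ+s•Y k σ) j τ) 0⟫
      = ∑ k, ∫ σ in {σ : ℝ | ‖X k σ‖ ≤ Rb * √(Γ * Real.log Γ)}, ⟪((∑ k', (Γ * γ k' / (4 * Real.pi)) • (∫ u, ((-3 * ((‖X k σ - X k' u‖ ^ 2 + Real.exp (-(1+Real.eulerMascheroniConstant-Real.log 2)) * Aa k' u) ^ (5 / 2 : ℝ))⁻¹ * ⟪(ψ k σ - ⟪ψ k σ, deriv (X k) σ⟫ • deriv (X k) σ), cross (deriv (X k') u) (X k σ - X k' u)⟫) • (X k σ - X k' u) + ((‖X k σ - X k' u‖ ^ 2 + Real.exp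 (-(1+Real.eulerMascheroniConstant-Real.log 2)) * Aa k' u) ^ (3 / 2 : ℝ))⁻¹ • cross (ψ k σ - ⟪ψ k σ, deriv (X k) σ⟫ • deriv (X k) σ) (deriv (X k') u)))) + (∑ j, (Γ * γ k / (4 * Real.pi)) • ((∫ τ in {σ : ℝ | ‖X j σ‖ ≤ Rb * √(Γ * Real.log Γ)}, ((3 * ((‖X j τ - X k σ‖ ^ 2 + Real.exp (-(1+Real.eulerMascheroniConstant-Real.log 2)) * Aa k σ) ^ (5 / 2 : ℝ))⁻¹ * ⟪(ψ j τ - ⟪ψ j τ, deriv (X j) τ⟫ • deriv (X j) τ), cross (deriv (X k) σ) (X j τ - X k σ)⟫) • (X j τ - X k σ) - ((‖X j τ - X k σ‖ ^ 2 + Real.exp (-(1+Real.eulerMascheroniConstant-Real.log 2)) * Aa k σ) ^ (3 / 2 : ℝ))⁻¹ • cross (ψ j τ - ⟪ψ j τ, deriv (X j) τ⟫ • deriv (X j) τ) (deriv (X k) σ))) - (∫ τ in {σ : ℝ | ‖X j σ‖ ≤ Rb * √(Γ * Real.log Γ)}, ((3 * ⟪X j τ - X k σ, deriv (X k) σ⟫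 * ((‖X j τ - X k σ‖ ^ 2 + Real.exp (-(1+Real.eulerMascheroniConstant-Real.log 2)) * Aa k (c k)) ^ (5 / 2 : ℝ))⁻¹) • cross (ψ j τ - ⟪ψ j τ, deriv (X j) τ⟫ • deriv (X j) τ) (X k σ - X j τ) + ((‖X j τ - X k σ‖ ^ 2 + Real.exp (-(1+Real.eulerMascheroniConstant-Real.log 2)) * Aa k (c k)) ^ (3 / 2 : ℝ))⁻¹ • cross (ψ j τ - ⟪ψ j τ, deriv (X j) τ⟫ • deriv (X j) τ) (deriv (X k) σ))))) + ((1 / 2 : ℝ) • (ψ k σ - ⟪ψ k σ, deriv (X k) σ⟫ • deriv (X k) σ) + α • cross (EuclideanSpace.single 2 1) (ψ k σ - ⟪ψ k σ, deriv (X k) σ⟫ • deriv (X k) σ)) + (deriv (w k) σ • (ψ k σ - ⟪ψ k σ, deriv (X k) σ⟫ • deriv (X k) σ) + w k σ • (deriv (ψ k) σ - (⟪deriv (ψ k) σ, deriv (X k) σ⟫ + ⟪ψ k σ, deriv (deriv (X k)) σ⟫) • deriv (X k) σ - ⟪ψ k σ, deriv (X k) σ⟫ • deriv (deriv (X k)) σ))),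 Y k σ⟫ := by
  obtain ⟨-, -, h3, -, -, h6, -, h8, -, -, -, h12, h13, -⟩ := hH u v A T hu hv hA hT
  obtain ⟨-, hwΛ, hAfl⟩ := hNS
  -- constants
  have hΛ : 0 < Λ := by
    obtain ⟨-, -, hlo, hhi⟩ := h12 ⟨0, hN⟩
    linarith
  have hκ : 0 < Real.exp (-(1+Real.eulerMascheroniConstant-Real.log 2)) := Real.exp_pos _
  have hlog : 0 < Real.log Γ := Real.log_pos hΓ
  have hΓ0 : 0 < Γ := by linarith
  have hℓ : 0 < Rb * √(Γ * Real.log Γ) := mul_pos hRb (Real.sqrt_pos.2 (mul_pos hΓ0 hlog))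
  -- clause data in the shape of the analytic identity
  have hX2 : ∀ k, ContDiff ℝ 2 (X k) := fun k => (h3 k).1
  have hunit : ∀ k σ, ‖deriv (X k) σ‖ = 1 := fun k σ => (h3 k).2.2.1 σ
  have hX1 : ∀ k σ, ‖deriv (X k) σ‖ ≤ 1 := fun k σ => (hunit k σ).le
  have hXg : ∀ k σ, cg * |σ| - (Rw * Real.sqrt Γ + cg * ∑ i, |c i|) ≤ ‖X k σ‖ := fun k σ => linearGrowth_of_cone hcg h6 k σ
  have hS : ∀ j, IsCompact {σ : ℝ | ‖X j σ‖ ≤ Rb * √(Γ * Real.log Γ)} := by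
    -- the ball of a continuous proper curve is compact (as in `…Clause13RCokernelCertificate.isCompact_ball_of_cocompact`, inlined to stay route-independent)
    intro j
    obtain ⟨K0, hK0, hK0sub⟩ := mem_cocompact.1 ((h3 j).2.2.2.2.eventually (eventually_gt_atTop (Rb * √(Γ * Real.log Γ))))
    refine hK0.of_isClosed_subset (isClosed_le (continuous_norm.comp (h3 j).1.continuous) continuous_const) ?_
    intro τ hτ
    by_contra hn
    have h' : Rb * √(Γ * Real.log Γ) < ‖X j τ‖ := hK0sub hn
    exact not_lt.2 hτ h'
  have hw : ∀ j, Differentiable ℝ (w j) := fun j => (h3 j).2.1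
  have hY1 : ∀ k, ContDiff ℝ 1 (Y k) := fun k => (hY2 k).of_le (by norm_num)
  have hAd : ∀ k, Differentiable ℝ (Aa k) := fun k => (h13 k).1
  have hm₀ : 0 < Real.exp (-(1+Real.eulerMascheroniConstant-Real.log 2)) * Λ⁻¹ := mul_pos hκ (inv_pos.2 hΛ)
  have hm : ∀ k σ, Real.exp (-(1+Real.eulerMascheroniConstant-Real.log 2)) * Λ⁻¹ ≤ Real.exp (-(1+Real.eulerMascheroniConstant-Real.log 2)) * Aa k σ := fun k σ => mul_le_mul_of_nonneg_left (hAfl k σ) hκ.le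
  have hmc : ∀ k, Continuous fun σ => Real.exp (-(1+Real.eulerMascheroniConstant-Real.log 2)) * Aa k σ := fun k => continuous_const.mul (hAd k).continuous
  have ha₀ : ∀ k, 0 < Real.exp (-(1+Real.eulerMascheroniConstant-Real.log 2)) * Aa k (c k) := fun k => mul_pos hκ ((h13 k).2.1 (c k))
  have hU : ∀ k, IsOpen {σ : ℝ | ‖X k σ‖ < 2*Rb*√(Γ*Real.log Γ)} := fun k =>
    isOpen_lt (continuous_norm.comp (h3 k).1.continuous) continuous_const
  have hmU : ∀ k σ, σ ∈ {σ : ℝ | ‖X k σ‖ < 2*Rb*√(Γ*Real.log Γ)} → Real.exp (-(1+Real.eulerMascheroniConstant-Real.log 2)) * Aa k σ = Real.exp (-(1+Real.eulerMascheroniConstant-Real.log 2)) * Aa k (c k) := by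
    intro k σ hσ
    rw [(h13 k).2.2.2 σ (le_of_lt hσ)]
  have hYU : ∀ k, tsupport (Y k) ⊆ {σ : ℝ | ‖X k σ‖ < 2*Rb*√(Γ*Real.log Γ)} := by
    intro k
    have hcl : IsClosed {σ : ℝ | ‖X k σ‖ ≤ Rb * √(Γ * Real.log Γ)} := isClosed_le (continuous_norm.comp (h3 k).1.continuous) continuous_const
    have hsupp : Function.support (Y k) ⊆ {σ : ℝ | ‖X k σ‖ ≤ Rb * √(Γ * Real.log Γ)} := by
      intro τ hτ
      by_contra hn
      exact hτ (hYoff k τ (not_le.1 hn))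
    intro τ hτ
    have hτS : τ ∈ {σ : ℝ | ‖X k σ‖ ≤ Rb * √(Γ * Real.log Γ)} := closure_minimal hsupp hcl hτ
    have hτS' : ‖X k τ‖ ≤ Rb * √(Γ * Real.log Γ) := hτS
    show ‖X k τ‖ < 2*Rb*√(Γ*Real.log Γ)
    nlinarith
  -- Step 1: the closed form of `DT·Y_j` at in-ball stations, inside the ball integrals
  have hcl : ∀ j, ∫ τ in {σ : ℝ | ‖X j σ‖ ≤ Rb * √(Γ * Real.log Γ)}, ⟪ψ j τ, deriv (fun s:ℝ => T (fun k σ => X k σ+s•Y k σ) j τ) 0⟫ = ∫ τ in {σ : ℝ | ‖X j σ‖ ≤ Rb * √(Γ * Real.log Γ)}, ⟪ψ j τ, (((∑ k, (Γ * γ k / (4 * Real.pi)) • ∫ σ, ((-3 * ⟪X j τ - X k σ, Y j τ - Y k σ⟫ * ((‖X j τ - X k σ‖ ^ 2 + Real.exp (-(1+Real.eulerMascheroniConstant-Real.log 2)) * Aa k σ) ^ (5 / 2 : ℝ))⁻¹) • cross (deriv (X k) σ) (X j τ - X k σ) + ((‖X j τ - X k σ‖ ^ 2 + Real.exp (-(1+Real.eulerMascheroniConstant-Real.log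 2)) * Aa k σ) ^ (3 / 2 : ℝ))⁻¹ • (cross (deriv (X k) σ) (Y j τ - Y k σ) + cross (deriv (Y k) σ) (X j τ - X k σ)))) + (1 / 2 : ℝ) • Y j τ - α • cross (EuclideanSpace.single 2 1) (Y j τ)) - ⟪((∑ k, (Γ * γ k / (4 * Real.pi)) • ∫ σ, ((-3 * ⟪X j τ - X k σ, Y j τ - Y k σ⟫ * ((‖X j τ - X k σ‖ ^ 2 + Real.exp (-(1+Real.eulerMascheroniConstant-Real.log 2)) * Aa k σ) ^ (5 / 2 : ℝ))⁻¹) • cross (deriv (X k) σ) (X j τ - X k σ) + ((‖X j τ - X k σ‖ ^ 2 + Real.exp (-(1+Real.eulerMascheroniConstant-Real.log 2)) * Aa k σ) ^ (3 / 2 : ℝ))⁻¹ • (cross (deriv (X k) σ) (Y j τ - Y k σ) + cross (deriv (Y k) σ) (X j τ - X k σ)))) + (1 / 2 : ℝ) • Y j τ - α • cross (EuclideanSpace.single 2 1) (Y j τ)), deriv (X j) τ⟫ • deriv (X j) τ + ((w j τ * ⟪deriv (X j) τ, deriv (Y j) τ⟫) • deriv (X j) τ - w j τ • deriv (Y j)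 τ))⟫ := by
    intro j
    refine setIntegral_congr_fun (isClosed_le (continuous_norm.comp (h3 j).1.continuous) continuous_const).measurableSet
      fun τ hτ => ?_
    have hin : ‖X j τ‖ ≤ Rb * Real.sqrt (Γ * Real.log Γ) := hτ
    rw [deriv_linearisedMap_inBall hu hv hT hX2 hunit hcg h6 h8 hAd (inv_pos.2 hΛ) hAfl hY2 hYoff j τ hin, add_sub_assoc]
  rw [Finset.sum_congr rfl fun j _ => hcl j]
  -- Step 2: the analytic identity
  exact adjoint_pairing_identity (m := fun k σ => Real.exp (-(1+Real.eulerMascheroniConstant-Real.log 2)) * Aa k σ) (a₀ := fun k => Real.exp (-(1+Real.eulerMascheroniConstant-Real.log 2)) * Aa k (c k))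
    (U := fun k => {σ : ℝ | ‖X k σ‖ < 2*Rb*√(Γ*Real.log Γ)}) (fun k => (Γ * γ k / (4 * Real.pi)))
    hX2 hX1 hcg hXg hS hw hwΛ hψ hY1 hYoff hm₀ hm hmc ha₀ hU hmU hYU

end Summit.NavierStokesRegularity.NavierStokesRegularity.Theorems.Clause13RClausePairing

end
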